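import Mathlib
import Summits.NavierStokesRegularity.NavierStokesRegularity.Theorems.LerayQuarterDissipationFiniteDissipationLiouvilleLambProductThreshold
import Literature.Analysis.FluidPDE.KochTataruKernel
import Summits.NavierStokesRegularity.NavierStokesRegularity.Theorems.DssFarFieldSlavingBlowupTypeIDssProfileSimilarityEnstrophySpaceThreshold
import HarnessLib

/-!
# Crux `FiniteDissipationLiouville` (stmt-NavierStokesRegularity-22144): CLOSED THRESHOLD ROWS ARE
# EXCEEDED BY A DEFINITE AMOUNT — a compactness collar lemma for the enveloped class, and the collars
# `1 + ε(C)` of the product, Λ-directional, cross-flow and time-constant rows, `½ + ε(C)` of the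
# space-constant row

Theorems file of route `LerayQuarterDissipation` (lead prover g18; `--supports` the crux; sequel of
`…LambProductThreshold`). Navier–Stokes regularity is NOT proved by anything here; no summit is.

A law-free threshold row whose endpoint is INCLUDED («hypothesis with constant `θ₀` ⇒ the field is
not singular at the apex») automatically acquires an ineffective collar on the enveloped class by
KNSS compactness, provided the hypothesis is closed under the convergence of `…Compactness.seqLimit`
with moving constants. This file records that scheme once and instantiates it:

* `exists_uniform_law_of_envelope` — the enveloped class with constant `C` (`IsTypeIAncientMild C`,
  `HasTypeIDecay C`) obeys ONE quarter-rate dissipation law `K(C)` (class-uniform gradient decay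
  `IsTypeIAncientMild.exists_forall_pow_mul_norm_iteratedFDeriv_le_of_hasTypeIDecay` + ns-lqd-p1's
  parabolic-scaling integration of `…Hardness`, inlined to stay outside the route's Theses cone),
  so persistence of singularities
  (`…Compactness.persistent_singularity_seq`) is available on it;
* **`exists_gap_of_closed`** — THE COLLAR LEMMA: if `P θ` is a family of properties, closed under
  KNSS limits with constants `θ_j → θ`, and `P θ₀` forbids an apex singularity on the enveloped
  class, then so does `P (θ₀ + ε)` for some `ε = ε(C) > 0`;
* **`exists_lambProduct_gap`** — for every `C` there is `ε > 0` such that NO enveloped member of the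
  class (constant `C`) with `√(−t)⟪V, ω × curl ω⟫ ≤ (1+ε)‖ω‖‖curl ω‖` everywhere is singular at the
  apex (closedness `…LambProductThreshold.lambProduct_closed_of_tendsto`, endpoint theorem
  `…not_singular_of_lambProduct_le_one`);
* `exists_lambDirection_gap`, `exists_crossFlow_gap`, `exists_timeConstant_gap` — the collars of the
  three sub-rows: Λ-directional `√(−t)⟪V, Λ⟫ ≤ (1+ε)‖Λ‖`, cross-flow `√(−t)‖ω × V‖ ≤ (1+ε)‖ω‖`
  (lead g17 left this collar open), Type-I constant `√(−t)‖V‖ ≤ 1 + ε` (a law-free analogue, on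
  the enveloped class, of lead g14's gap `C ≤ 1 + ε(K)` on the finite-dissipation stratum);
* `exists_spaceConstant_gap` — the collar of the tree's CLOSED space-constant row
  (`…SimilarityEnstrophy.typeI_ancient_eq_zero_of_spaceConstant_le_half`, Hardy: `‖x‖‖V‖ ≤ ½ ⇒ V ≡ 0`):
  `‖x‖‖V(t,x)‖ ≤ ½ + ε(C)` everywhere already forbids an apex singularity;
* `lambProduct_exceeds_gap_of_singular` — PORTRAIT: a singular enveloped member (constants equalised
  to `A`) has a point with `(1 + ε(A))‖ω‖‖curl ω‖ < √(−t)⟪V, ω × curl ω⟫`, and a point with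
  `(½ + ε'(A)) < ‖x‖‖V(t,x)‖`.

HONEST FRAMING. Every `ε` here is INEFFECTIVE (compactness and contradiction) and the conclusion is
«not singular at the apex», not `V ≡ 0`; necessary conditions on a HYPOTHETICAL object; nothing is
removed from the catalogued DSS wall beyond these sub-classes; verdict of the line unchanged
(FRONTIER). Nothing here bears on Navier–Stokes regularity.

References: Koch–Nadirashvili–Seregin–Šverák, Acta Math. 203 (2009) §4 (compactness, persistence);
Bradshaw–Tsai, Comm. PDE 42 (2017) §5; folklore.
-/

noncomputable section

set_option linter.dupNamespace false

namespace Summit.NavierStokesRegularity.NavierStokesRegularity.Theorems.FiniteDissipationLiouville.LambProduct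

open MeasureTheory Set Filter Topology Metric InnerProductSpace Function Real
open scoped RealInnerProductSpace ContDiff
open Literature.Analysis Literature.Analysis.FluidPDE
open Summit.NavierStokesRegularity.NavierStokesRegularity.Theorems
open Summit.NavierStokesRegularity.NavierStokesRegularity.Theorems.GaussianGap
open Summit.NavierStokesRegularity.NavierStokesRegularity.Theorems.SimilarityEnstrophy
open Summit.NavierStokesRegularity.NavierStokesRegularity.Theorems.RecurrentReductionD
open Summit.NavierStokesRegularity.NavierStokesRegularity.Theorems.FiniteDissipationLiouville
open Summit.NavierStokesRegularity.NavierStokesRegularity.Theorems.FiniteDissipationLiouville.CrossFlow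
open Summit.NavierStokesRegularity.NavierStokesRegularity.Theorems.FiniteDissipationLiouville.EndpointScheme

variable {C : ℝ} {V : ℝ → EuclideanSpace ℝ (Fin 3) → EuclideanSpace ℝ (Fin 3)}

/-! ### One dissipation law for the whole enveloped class -/

/-- **The enveloped class obeys one quarter-rate dissipation law.** For every `C` there is `K` such
that every KNSS-gauge Type-I field with `IsTypeIAncientMild C V` and `HasTypeIDecay C V` satisfies
`∫‖∇V(s)‖² ≤ K/√(−s)` for all `s < 0` (class-uniform gradient decay + parabolic scaling).
[cite: KochNadirashviliSereginSverak2009, Prop. 4.1 (arXiv:0709.3599 p. 8)] -/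
theorem exists_uniform_law_of_envelope (C : ℝ) : ∃ K : ℝ,
    ∀ ⦃V : ℝ → EuclideanSpace ℝ (Fin 3) → EuclideanSpace ℝ (Fin 3)⦄,
      IsTypeIAncientMild C V → HasTypeIDecay C V →
      ∀ s : ℝ, s < 0 → ∫⁻ x, ‖fderiv ℝ (V s) x‖ₑ ^ 2 ≤ ENNReal.ofReal (K / Real.sqrt (-s)) := by
  -- the integration step is ns-lqd-p1's `…Hardness.lintegral_fderiv_sq_le_of_gradDecay`, inlined
  -- here to keep this module outside the route's Theses cone
  obtain ⟨K₁, -, hK₁⟩ :=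
    IsTypeIAncientMild.exists_forall_pow_mul_norm_iteratedFDeriv_le_of_hasTypeIDecay 1 C
  set I₂ : ℝ := ∫ w : EuclideanSpace ℝ (Fin 3), (1 + ‖w‖ ^ 2) ^ (-(2 : ℝ)) with hI₂_def
  refine ⟨K₁ ^ 2 * I₂, fun V hV hdec s hs => ?_⟩
  have hK : ∀ t : ℝ, t < 0 → ∀ x, (‖x‖ + Real.sqrt (-t)) ^ 2 * ‖fderiv ℝ (V t) x‖ ≤ K₁ := by
    intro t ht x
    have h := hK₁ hV hdec t ht x
    rwa [norm_iteratedFDeriv_one, show (1 + 1 : ℕ) = 2 from rfl] at h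
  have hσ : 0 < -s := neg_pos.2 hs
  have ha : 0 < Real.sqrt (-s) := Real.sqrt_pos.2 hσ
  have hpt : ∀ x : EuclideanSpace ℝ (Fin 3), ‖fderiv ℝ (V s) x‖ₑ ^ 2 ≤
      ENNReal.ofReal (K₁ ^ 2) * ENNReal.ofReal ((-s + ‖x‖ ^ 2) ^ (-(2 : ℝ))) := by
    intro x
    have hden : 0 < (‖x‖ + Real.sqrt (-s)) ^ 2 := by positivity
    have h1 : ‖fderiv ℝ (V s) x‖ ≤ K₁ / (‖x‖ + Real.sqrt (-s)) ^ 2 := by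
      rw [le_div_iff₀ hden, mul_comm]
      exact hK s hs x
    have h2 : ‖fderiv ℝ (V s) x‖ ^ 2 ≤ K₁ ^ 2 / ((‖x‖ + Real.sqrt (-s)) ^ 2) ^ 2 := by
      rw [← div_pow]
      exact pow_le_pow_left₀ (norm_nonneg _) h1 2
    have hbase : 0 < -s + ‖x‖ ^ 2 := by positivity
    have h3 : K₁ ^ 2 / ((‖x‖ + Real.sqrt (-s)) ^ 2) ^ 2 ≤ K₁ ^ 2 * (-s + ‖x‖ ^ 2) ^ (-(2 : ℝ)) := by
      rw [Real.rpow_neg hbase.le, ← div_eq_mul_inv]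
      have hsq : (-s + ‖x‖ ^ 2) ^ (2 : ℝ) = (-s + ‖x‖ ^ 2) ^ (2 : ℕ) := by
        rw [← Real.rpow_natCast]
        norm_num
      rw [hsq]
      refine div_le_div_of_nonneg_left (sq_nonneg K₁) (by positivity) ?_
      refine pow_le_pow_left₀ hbase.le ?_ 2
      nlinarith [Real.sq_sqrt hσ.le, norm_nonneg x, Real.sqrt_nonneg (-s)]
    calc ‖fderiv ℝ (V s) x‖ₑ ^ 2 = ENNReal.ofReal (‖fderiv ℝ (V s) x‖ ^ 2) := by
          rw [← ofReal_norm, ENNReal.ofReal_pow (norm_nonneg _)]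
      _ ≤ ENNReal.ofReal (K₁ ^ 2 * (-s + ‖x‖ ^ 2) ^ (-(2 : ℝ))) :=
          ENNReal.ofReal_le_ofReal (h2.trans h3)
      _ = ENNReal.ofReal (K₁ ^ 2) * ENNReal.ofReal ((-s + ‖x‖ ^ 2) ^ (-(2 : ℝ))) :=
          ENNReal.ofReal_mul (sq_nonneg K₁)
  have h3 : (Module.finrank ℝ (EuclideanSpace ℝ (Fin 3)) : ℝ) < 2 * 2 := by
    rw [finrank_euclideanSpace_fin]; norm_num
  have hexp : ((Module.finrank ℝ (EuclideanSpace ℝ (Fin 3)) : ℝ) / 2 - 2) = -(1 / 2 : ℝ) := by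
    rw [finrank_euclideanSpace_fin]; norm_num
  have hint : ∫⁻ x : EuclideanSpace ℝ (Fin 3), ENNReal.ofReal ((-s + ‖x‖ ^ 2) ^ (-(2 : ℝ))) =
      ENNReal.ofReal ((-s) ^ (-(1 / 2 : ℝ)) * I₂) := by
    rw [lintegral_add_norm_sq_rpow_neg h3 hσ, hexp]
  have hhalf : (-s) ^ (-(1 / 2 : ℝ)) = (Real.sqrt (-s))⁻¹ := by
    rw [Real.rpow_neg hσ.le, Real.sqrt_eq_rpow]
  calc ∫⁻ x, ‖fderiv ℝ (V s) x‖ₑ ^ 2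
      ≤ ∫⁻ x : EuclideanSpace ℝ (Fin 3),
          ENNReal.ofReal (K₁ ^ 2) * ENNReal.ofReal ((-s + ‖x‖ ^ 2) ^ (-(2 : ℝ))) :=
        lintegral_mono hpt
    _ = ENNReal.ofReal (K₁ ^ 2) *
          ∫⁻ x : EuclideanSpace ℝ (Fin 3), ENNReal.ofReal ((-s + ‖x‖ ^ 2) ^ (-(2 : ℝ))) := by
        rw [lintegral_const_mul' _ _ ENNReal.ofReal_ne_top]
    _ = ENNReal.ofReal (K₁ ^ 2 * ((-s) ^ (-(1 / 2 : ℝ)) * I₂)) := by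
        rw [hint, ← ENNReal.ofReal_mul (sq_nonneg K₁)]
    _ = ENNReal.ofReal ((K₁ ^ 2 * I₂) / Real.sqrt (-s)) := by
        rw [hhalf, div_eq_mul_inv]
        ring_nf

/-! ### The collar lemma -/

/-- **THE COLLAR OF A CLOSED THRESHOLD ROW (compactness).** Let `P : ℝ → (field → Prop)` be a family
of properties which is closed under the KNSS convergence of `…Compactness.seqLimit` inside the class
`IsTypeIAncientMild C` with moving constants `θ_j → θ`, and suppose `P θ₀` forbids an apex
singularity for every enveloped member (`HasTypeIDecay C`). Then there is `ε > 0` such that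
`P (θ₀ + ε)` already forbids it: otherwise singular enveloped members with `P (θ₀ + 1/(n+1))`
subconverge (KNSS) to an enveloped member with `P θ₀` which is singular by persistence under the
class-uniform law. [cite: KochNadirashviliSereginSverak2009, §4 (arXiv:0709.3599 p. 8)] -/
theorem exists_gap_of_closed
    {P : ℝ → (ℝ → EuclideanSpace ℝ (Fin 3) → EuclideanSpace ℝ (Fin 3)) → Prop} {θ₀ : ℝ}
    (hclosed : ∀ (u : ℕ → ℝ → EuclideanSpace ℝ (Fin 3) → EuclideanSpace ℝ (Fin 3))
        (W : ℝ → EuclideanSpace ℝ (Fin 3) → EuclideanSpace ℝ (Fin 3)) (θ : ℕ → ℝ) (θinf : ℝ),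
      (∀ j, IsTypeIAncientMild C (u j)) → (∀ j, P (θ j) (u j)) → Tendsto θ atTop (𝓝 θinf) →
      IsTypeIAncientMild C W →
      (∀ n : ℕ, TendstoUniformlyOn (fun j z => u j z.1 z.2) (fun z => W z.1 z.2) atTop
        (Icc (-((n : ℝ) + 2)) (-(1 / ((n : ℝ) + 2))) ×ˢ
          closedBall (0 : EuclideanSpace ℝ (Fin 3)) ((n : ℝ) + 2))) →
      (∀ t < 0, ∀ x, Tendsto (fun j => u j t x) atTop (𝓝 (W t x))) →
      (∀ t < 0, ∀ x, Tendsto (fun j => fderiv ℝ (u j t) x) atTop (𝓝 (fderiv ℝ (W t) x))) →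
      P θinf W)
    (hkill : ∀ V : ℝ → EuclideanSpace ℝ (Fin 3) → EuclideanSpace ℝ (Fin 3), IsTypeIAncientMild C V →
      HasTypeIDecay C V → P θ₀ V →
      ¬ (∀ r > 0, ∀ M : ℝ, ∃ t ∈ Ioo (-(r ^ 2)) (0 : ℝ),
        ∃ x ∈ ball (0 : EuclideanSpace ℝ (Fin 3)) r, M < ‖V t x‖)) :
    ∃ ε : ℝ, 0 < ε ∧
      ∀ V : ℝ → EuclideanSpace ℝ (Fin 3) → EuclideanSpace ℝ (Fin 3), IsTypeIAncientMild C V →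
        HasTypeIDecay C V → P (θ₀ + ε) V →
        ¬ (∀ r > 0, ∀ M : ℝ, ∃ t ∈ Ioo (-(r ^ 2)) (0 : ℝ),
          ∃ x ∈ ball (0 : EuclideanSpace ℝ (Fin 3)) r, M < ‖V t x‖) := by
  by_contra hcon
  push Not at hcon
  -- singular enveloped members with constants `θ₀ + 1/(n+1)`
  have hk : ∀ n : ℕ, ∃ u : ℝ → EuclideanSpace ℝ (Fin 3) → EuclideanSpace ℝ (Fin 3),
      IsTypeIAncientMild C u ∧ HasTypeIDecay C u ∧ P (θ₀ + 1 / ((n : ℝ) + 1)) u ∧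
      (∀ r > 0, ∀ M : ℝ, ∃ t ∈ Ioo (-(r ^ 2)) (0 : ℝ),
        ∃ x ∈ ball (0 : EuclideanSpace ℝ (Fin 3)) r, M < ‖u t x‖) := by
    intro n
    obtain ⟨u, hu, hdu, hP, hsing⟩ := hcon (1 / ((n : ℝ) + 1)) (by positivity)
    exact ⟨u, hu, hdu, hP, hsing⟩
  choose u hu hdu hPu hsing using hk
  -- the common law of the enveloped class; compactness; persistence of the singularity
  obtain ⟨K, hK⟩ := exists_uniform_law_of_envelope C
  have hlaw : ∀ n, ∀ s : ℝ, s < 0 →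
      ∫⁻ x, ‖fderiv ℝ (u n s) x‖ₑ ^ 2 ≤ ENNReal.ofReal (K / Real.sqrt (-s)) :=
    fun n => hK (hu n) (hdu n)
  obtain ⟨ψ, hψ, W, hW, hunif, hpt, hgr⟩ := Compactness.seqLimit hu
  have hψt : Tendsto ψ atTop atTop := hψ.tendsto_atTop
  have hWsing := Compactness.persistent_singularity_seq (w := fun j => u (ψ j))
    (fun j => hu _) (fun j => hlaw _) (fun j => hsing _) hW hunif
  -- the limit is enveloped and sits AT the threshold
  have hdW : HasTypeIDecay C W := fun t ht x =>
    le_of_tendsto (hpt t ht x).norm (Eventually.of_forall fun j => hdu (ψ j) t ht x)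
  have hθ : Tendsto (fun j => θ₀ + 1 / (((ψ j : ℕ) : ℝ) + 1)) atTop (𝓝 θ₀) := by
    have h := (tendsto_one_div_add_atTop_nhds_zero_nat.comp hψt).const_add θ₀
    rw [add_zero] at h
    exact h
  have hPW : P θ₀ W := hclosed (fun j => u (ψ j)) W (fun j => θ₀ + 1 / (((ψ j : ℕ) : ℝ) + 1)) θ₀
    (fun j => hu (ψ j)) (fun j => hPu (ψ j)) hθ hW hunif hpt hgr
  exact hkill W hW hdW hPW hWsing

/-! ### The collar of the product threshold and of its sub-rows -/

/-- **THE PRODUCT BOUND OF A SINGULAR ENVELOPED MEMBER EXCEEDS `1` BY A DEFINITE AMOUNT.** For every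
`C` there is `ε > 0` such that no KNSS-gauge Type-I field with `IsTypeIAncientMild C V`,
`HasTypeIDecay C V` and `√(−t)⟪V, ω × curl ω⟫ ≤ (1 + ε)‖ω‖‖curl ω‖` everywhere is singular at the
apex. [cite: KochNadirashviliSereginSverak2009, §4 (arXiv:0709.3599 p. 8)] -/
theorem exists_lambProduct_gap (C : ℝ) : ∃ ε : ℝ, 0 < ε ∧
    ∀ V : ℝ → EuclideanSpace ℝ (Fin 3) → EuclideanSpace ℝ (Fin 3), IsTypeIAncientMild C V →
      HasTypeIDecay C V →
      (∀ t < 0, ∀ x, Real.sqrt (-t) * ⟪V t x, cross (curl (V t) x) (curl (curl (V t)) x)⟫ ≤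
        (1 + ε) * (‖curl (V t) x‖ * ‖curl (curl (V t)) x‖)) →
      ¬ (∀ r > 0, ∀ M : ℝ, ∃ t ∈ Ioo (-(r ^ 2)) (0 : ℝ),
        ∃ x ∈ ball (0 : EuclideanSpace ℝ (Fin 3)) r, M < ‖V t x‖) := by
  refine exists_gap_of_closed (C := C) (θ₀ := 1)
    (P := fun θ F => ∀ t < 0, ∀ x,
      Real.sqrt (-t) * ⟪F t x, cross (curl (F t) x) (curl (curl (F t)) x)⟫ ≤
        θ * (‖curl (F t) x‖ * ‖curl (curl (F t)) x‖))
    (fun u W θ θinf hu hPu hθ hW hunif hpt hgr =>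
      lambProduct_closed_of_tendsto hu hW hunif hpt hgr hθ hPu)
    (fun V hV hdec hP => not_singular_of_lambProduct_le_one hV hdec fun t ht x => ?_)
  have := hP t ht x
  rwa [one_mul] at this

/-- **The Λ-directional collar**: for every `C` there is `ε > 0` such that no enveloped member of the
class with `√(−t)⟪V, ω × curl ω⟫ ≤ (1 + ε)‖ω × curl ω‖` everywhere is singular. [folklore] -/
theorem exists_lambDirection_gap (C : ℝ) : ∃ ε : ℝ, 0 < ε ∧
    ∀ V : ℝ → EuclideanSpace ℝ (Fin 3) → EuclideanSpace ℝ (Fin 3), IsTypeIAncientMild C V →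
      HasTypeIDecay C V →
      (∀ t < 0, ∀ x, Real.sqrt (-t) * ⟪V t x, cross (curl (V t) x) (curl (curl (V t)) x)⟫ ≤
        (1 + ε) * ‖cross (curl (V t) x) (curl (curl (V t)) x)‖) →
      ¬ (∀ r > 0, ∀ M : ℝ, ∃ t ∈ Ioo (-(r ^ 2)) (0 : ℝ),
        ∃ x ∈ ball (0 : EuclideanSpace ℝ (Fin 3)) r, M < ‖V t x‖) := by
  obtain ⟨ε, hε, h⟩ := exists_lambProduct_gap C
  refine ⟨ε, hε, fun V hV hdec hΛ => h V hV hdec fun t ht x => (hΛ t ht x).trans ?_⟩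
  exact mul_le_mul_of_nonneg_left (norm_cross_le_norm_mul_norm _ _) (by linarith)

/-- **The cross-flow collar** (left open by lead g17): for every `C` there is `ε > 0` such that no
enveloped member of the class with `√(−t)‖ω × V‖ ≤ (1 + ε)‖ω‖` everywhere is singular. [folklore] -/
theorem exists_crossFlow_gap (C : ℝ) : ∃ ε : ℝ, 0 < ε ∧
    ∀ V : ℝ → EuclideanSpace ℝ (Fin 3) → EuclideanSpace ℝ (Fin 3), IsTypeIAncientMild C V →
      HasTypeIDecay C V →
      (∀ t < 0, ∀ x, Real.sqrt (-t) * ‖cross (curl (V t) x) (V t x)‖ ≤ (1 + ε) * ‖curl (V t) x‖) →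
      ¬ (∀ r > 0, ∀ M : ℝ, ∃ t ∈ Ioo (-(r ^ 2)) (0 : ℝ),
        ∃ x ∈ ball (0 : EuclideanSpace ℝ (Fin 3)) r, M < ‖V t x‖) := by
  obtain ⟨ε, hε, h⟩ := exists_lambProduct_gap C
  refine ⟨ε, hε, fun V hV hdec hX => h V hV hdec fun t ht x => ?_⟩
  have hs : 0 ≤ Real.sqrt (-t) := Real.sqrt_nonneg _
  have h1 : ‖cross (curl (V t) x) (Real.sqrt (-t) • V t x)‖ ≤ (1 + ε) * ‖curl (V t) x‖ := by
    rw [cross_smul_right, norm_smul, Real.norm_of_nonneg hs]; exact hX t ht x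
  have h2 := inner_lamb_le_of_crossFlow (θ := 1 + ε) (Real.sqrt (-t) • V t x) (curl (V t) x)
    (curl (curl (V t)) x) h1
  rwa [real_inner_smul_left] at h2

/-- **The Type-I-constant collar on the enveloped class** (law-free analogue of lead g14's
`…ThresholdOne.exists_typeI_gap`): for every `C` there is `ε > 0` such that no KNSS-gauge Type-I
field with `IsTypeIAncientMild C V`, `HasTypeIDecay C V` and `√(−t)‖V(t,x)‖ ≤ 1 + ε` everywhere is
singular at the apex. [folklore] -/
theorem exists_timeConstant_gap (C : ℝ) : ∃ ε : ℝ, 0 < ε ∧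
    ∀ V : ℝ → EuclideanSpace ℝ (Fin 3) → EuclideanSpace ℝ (Fin 3), IsTypeIAncientMild C V →
      HasTypeIDecay C V →
      (∀ t < 0, ∀ x, Real.sqrt (-t) * ‖V t x‖ ≤ 1 + ε) →
      ¬ (∀ r > 0, ∀ M : ℝ, ∃ t ∈ Ioo (-(r ^ 2)) (0 : ℝ),
        ∃ x ∈ ball (0 : EuclideanSpace ℝ (Fin 3)) r, M < ‖V t x‖) := by
  obtain ⟨ε, hε, h⟩ := exists_lambProduct_gap C
  refine ⟨ε, hε, fun V hV hdec hb => h V hV hdec fun t ht x => ?_⟩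
  have hs : 0 ≤ Real.sqrt (-t) := Real.sqrt_nonneg _
  set X : EuclideanSpace ℝ (Fin 3) := cross (curl (V t) x) (curl (curl (V t)) x) with hXdef
  calc Real.sqrt (-t) * ⟪V t x, X⟫ ≤ Real.sqrt (-t) * (‖V t x‖ * ‖X‖) :=
        mul_le_mul_of_nonneg_left (real_inner_le_norm _ _) hs
    _ = (Real.sqrt (-t) * ‖V t x‖) * ‖X‖ := by ring
    _ ≤ (1 + ε) * ‖X‖ := mul_le_mul_of_nonneg_right (hb t ht x) (norm_nonneg _)
    _ ≤ (1 + ε) * (‖curl (V t) x‖ * ‖curl (curl (V t)) x‖) :=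
        mul_le_mul_of_nonneg_left (norm_cross_le_norm_mul_norm _ _) (by linarith)

/-! ### The collar of the space-constant row -/

/-- **The space-constant collar**: the tree's closed row `‖x‖‖V(t,x)‖ ≤ ½ ⇒ V ≡ 0` (Hardy;
`…SimilarityEnstrophy.typeI_ancient_eq_zero_of_spaceConstant_le_half`) is exceeded by a definite
amount — for every `C` there is `ε > 0` such that no KNSS-gauge Type-I field with
`IsTypeIAncientMild C V`, `HasTypeIDecay C V` and `‖x‖‖V(t,x)‖ ≤ ½ + ε` everywhere is singular at the
apex. [folklore] -/
theorem exists_spaceConstant_gap (C : ℝ) : ∃ ε : ℝ, 0 < ε ∧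
    ∀ V : ℝ → EuclideanSpace ℝ (Fin 3) → EuclideanSpace ℝ (Fin 3), IsTypeIAncientMild C V →
      HasTypeIDecay C V →
      (∀ t < 0, ∀ x, ‖x‖ * ‖V t x‖ ≤ 1 / 2 + ε) →
      ¬ (∀ r > 0, ∀ M : ℝ, ∃ t ∈ Ioo (-(r ^ 2)) (0 : ℝ),
        ∃ x ∈ ball (0 : EuclideanSpace ℝ (Fin 3)) r, M < ‖V t x‖) := by
  refine exists_gap_of_closed (C := C) (θ₀ := 1 / 2)
    (P := fun θ F => ∀ t < 0, ∀ x, ‖x‖ * ‖F t x‖ ≤ θ)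
    (fun u W θ θinf hu hPu hθ hW hunif hpt hgr t ht x =>
      le_of_tendsto_of_tendsto' ((hpt t ht x).norm.const_mul ‖x‖) hθ fun j => hPu j t ht x)
    (fun V hV hdec hP hsing => ?_)
  obtain ⟨t, ht, x, -, hM⟩ := hsing 1 one_pos 0
  rw [typeI_ancient_eq_zero_of_spaceConstant_le_half hV hP le_rfl t ht.2 x, norm_zero] at hM
  exact lt_irrefl _ hM

/-! ### Portrait -/

/-- **PORTRAIT: the product bound is exceeded by a definite amount.** For every `A` there is
`ε = ε(A) > 0` such that every KNSS-gauge Type-I field with `IsTypeIAncientMild C V`, `C ≤ A`, and a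
Type-I envelope `HasTypeIDecay A V` which is SINGULAR at the apex has a point `(t,x)`, `t < 0`, with
`(1 + ε)‖ω‖‖curl ω‖ < √(−t)⟪V, ω × curl ω⟫`. [folklore energy method + KNSS compactness] -/
theorem lambProduct_exceeds_gap_of_singular (A : ℝ) : ∃ ε : ℝ, 0 < ε ∧
    ∀ (C : ℝ) (V : ℝ → EuclideanSpace ℝ (Fin 3) → EuclideanSpace ℝ (Fin 3)),
      IsTypeIAncientMild C V → C ≤ A → HasTypeIDecay A V →
      (∀ r > 0, ∀ M : ℝ, ∃ t ∈ Ioo (-(r ^ 2)) (0 : ℝ),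
        ∃ x ∈ ball (0 : EuclideanSpace ℝ (Fin 3)) r, M < ‖V t x‖) →
      ∃ t : ℝ, t < 0 ∧ ∃ x : EuclideanSpace ℝ (Fin 3),
        (1 + ε) * (‖curl (V t) x‖ * ‖curl (curl (V t)) x‖) <
          Real.sqrt (-t) * ⟪V t x, cross (curl (V t) x) (curl (curl (V t)) x)⟫ := by
  obtain ⟨ε, hε, h⟩ := exists_lambProduct_gap A
  refine ⟨ε, hε, fun C V hV hCA hdec hsing => ?_⟩
  by_contra hc
  push Not at hc
  exact h V (isTypeIAncientMild_of_le hV hCA) hdec hc hsing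

/-- **PORTRAIT: the space constant of a singular enveloped member exceeds `½` by a definite amount**:
for every `A` there is `ε' = ε'(A) > 0` such that every singular member as above has a point with
`½ + ε' < ‖x‖‖V(t,x)‖`. [folklore energy method + KNSS compactness] -/
theorem spaceConstant_exceeds_gap_of_singular (A : ℝ) : ∃ ε : ℝ, 0 < ε ∧
    ∀ (C : ℝ) (V : ℝ → EuclideanSpace ℝ (Fin 3) → EuclideanSpace ℝ (Fin 3)),
      IsTypeIAncientMild C V → C ≤ A → HasTypeIDecay A V →
      (∀ r > 0, ∀ M : ℝ, ∃ t ∈ Ioo (-(r ^ 2)) (0 : ℝ),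
        ∃ x ∈ ball (0 : EuclideanSpace ℝ (Fin 3)) r, M < ‖V t x‖) →
      ∃ t : ℝ, t < 0 ∧ ∃ x : EuclideanSpace ℝ (Fin 3), 1 / 2 + ε < ‖x‖ * ‖V t x‖ := by
  obtain ⟨ε, hε, h⟩ := exists_spaceConstant_gap A
  refine ⟨ε, hε, fun C V hV hCA hdec hsing => ?_⟩
  by_contra hc
  push Not at hc
  exact h V (isTypeIAncientMild_of_le hV hCA) hdec hc hsing

end Summit.NavierStokesRegularity.NavierStokesRegularity.Theorems.FiniteDissipationLiouville.LambProduct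

end
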